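/-
Copyright: the b2b-balaban T⁴-continuum CRUX team, row NE7b OWNER lineage `t4-ne7b-p1` (gen 124). Project licence.
-/
import Summits.QuantumFields.BalabanUV.T4Continuum.Spine.NE7b.SupZdExponentialSums

/-!
# DATA THAT AGREE ON A REGION GIVE BOUNDED `ℤ^d` SOLUTIONS THAT AGREE THERE EXPONENTIALLY: for two potentials `V₁, V₂ : ℤ^d → [−λ, Λ]`
# and bounded sources `f₁, f₂` coinciding on the blocks of a coarse set `A`, the bounded solutions of `H_{V_i}u_i = f_i` (`d ≥ 3`, every
# mesh) satisfy `|u₁(p) − u₂(p)| ≤ C·‖f‖_∞·e^{−δ·dist₁(blk n p, ℤ^d ∖ A)}` with `(C, δ)` from `(d, a, λ, Λ)` ONLY — by BLOCK SUPERPOSITION: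
# a bounded source vanishing on the blocks of `A` has the bounded solution `Σ′_{c ∉ A}w_c` ((180)'s decaying block solutions; the finite
# stencil passes through the absolutely convergent series; (181) uniqueness), which is `≤ C·M·Σ_{c ∉ A}e^{−δ|blk n p − c|₁}`.  The
# infinite-volume twin of (178)∕(179), and the seam estimate behind the torus → `ℤ^d` limit of the next-scale Hessian (row NE7b, node U5c;
# (180)∕(181)∕(189) BY NAME; [folklore])

Cell `pub-balaban`, sub-cell `t4`, spine estimate NE7b (`T4WeightBudget.RelWeightBound`; the cell's OWN estimate — NOT PRINTED in
[Bałaban 1983–89], NOT PROVED).  Crux-route work under `Spine/NE7b/` by the row OWNER (`t4-ne7b-p1` gen 124, file (196)) under FREEZE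
(0)'s crux-prover clause; NOTHING of Bałaban's is named as a Lean object, valued or asserted; no `T4Continuum/Support` leaf typed; no `def`,
no notation (the `ℤ^d` operator DISPLAYED; the superposition is an `∃ W`); zero `sorry`.  Imports (BY NAME): the OWNER's (189)
`…SupZdExponentialSums` (`summable_exp_l1`, `tsum_exp_l1_le`; through it (180) `zd_propagator_exists`, `zd_solution_exists`, (181)
`zd_bounded_null_solution_eq_zero`, `zd_bounded_solution_unique`), Mathlib's `Summable.tsum_finsetSum`, `Summable.tsum_add ∕ tsum_sub ∕
tsum_mul_left`, `norm_tsum_le_tsum_norm`, `tsum_eq_single`.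

WHY (located).  The torus next-scale Hessians `(n+1)^dT_k⁻¹` converge to the infinite-volume one `(n+1)^dM` ((194)∕(195)) through [B4]
(5.10) on the coarse torus, whose hypothesis (5.9) is a SEAM-LOCALISED bound on `T_k(y,y′) − T_∞(wm y, wm y′)`, i.e. on the block means of
`ψ^k_{y′}∘σ − Ψ_{wm y′}` — two bounded `ℤ^d` solutions ((185): the lift of the torus column solves the `ℤ^d` equation with the periodised
data) whose data agree away from the seam.  This file is the `ℤ^d` estimate that turns «data agree on the blocks of `A`» into
«solutions agree up to `e^{−δ·dist(·, Aᶜ)}`», mesh-uniformly: the difference solves `H_{V₁}w = f₁ − f₂ − (V₁ − V₂)u₂ =: g`, `g = 0` on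
the blocks of `A`, `|g| ≤ (2 + 2(|λ| + Λ)C₀)M`; block pieces (NOT point columns — (190)'s fine-scale kernel bound would cost `(n+1)^d`)
have (180)'s decaying solutions, the pieces over `A` vanish ((181)), and the series of the others is bounded, solves the equation, hence IS
`w`, and is small far from `ℤ^d ∖ A`.

WHAT IS PROVED ([folklore]; `X d = ℤ^d`; the operator `(H_V u)(p) = (n+1)²Σ_μ(2u p − u(p ± ê_μ)) + a(n+1)^{−d}Σ_{B n (blk n p)}u + V p·u p`
DISPLAYED): §1 **`zd_block_superposition`** (`∃ C δ > 0`: for ALL `n, V`, `|g| ≤ M_g` with `g = 0` on the blocks of `A`: `∃ W`, `H_VW = g`,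
`|W| ≤ CM_g`, and `|W(p)| ≤ CM_ge^{−δD}` whenever `D ≤ |blk n p − c|₁` for all `c ∉ A`); §2 **`zd_data_agreement`** (THE END: `∃ C δ > 0`:
for ALL `n`, `V₁, V₂` of the class, `|f₁|,|f₂| ≤ M`, bounded solutions `u₁, u₂`, data agreeing on the blocks of `A`:
`|u₁(p) − u₂(p)| ≤ CMe^{−δD}` for every `D ≤ dist₁(blk n p, ℤ^d ∖ A)`); §3 toy.

HONEST (what this is NOT).  A linear comparison lemma — the seam estimate for the coarse operators and the torus limit of `T_k⁻¹` are the
sequel; `d ≥ 3` only; the LINEAR column only; scalar skeleton ((A3), NC-NE7b-α UNRULED); nothing of the covariant propagators of [B4]–[B6];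
nothing of Bałaban's asserted.  BY-NAME EFFECT ON THE WALL: NONE.  NE7b NOT PRINTED ∕ NOT PROVED; spine PROVED 0∕9; rung (B)+1 — the
programme's measures remain FINITE-torus statements; NOT the mass gap, NOT Clay.  HONEST DEPENDENCY: continuum YM on T⁴ ⇐ BetaPertH ∧
nine spine estimates (0∕9 proved); BetaPertH ⇐ (D1) ∧ (D4) ∧ CAP+tail; G-an2-4 gates asym, D1 and NE2∕3∕4.
-/

set_option autoImplicit false

noncomputable section

namespace Summit.QuantumFields.BalabanUV.T4Continuum.NE7b.SupZdDataAgreement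

open Real Filter Topology
open Literature.MathematicalPhysics.QuantumFieldTheory.Balaban1983to89
open B6QGQLower276 (X e blk B side chart mem_B sum_B sum_B_const card_cube blk_chart)
open SupZdPropagatorLimit (zd_propagator_exists zd_solution_exists)
open SupZdPropagatorUniqueness (zd_bounded_null_solution_eq_zero zd_bounded_solution_unique)
open SupZdExponentialSums (summable_exp_l1 tsum_exp_l1_le)

variable {d : ℕ}

/-! ## §1. Block superposition on `ℤ^d`: a bounded source is the sum of its block pieces, and so is its bounded solution -/

/-- **BLOCK SUPERPOSITION**: `∃ C δ > 0` from `(d, a, λ, Λ)` such that for ALL `n`, `V : ℤ^d → [−λ, Λ]`, every bounded source `|g| ≤ M_g`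
vanishing on the blocks of a set `A` of coarse points, the series `W = Σ′_c w_c` of the decaying solutions `w_c` of the block pieces
`g·𝟙_{B n c}` ((180)) converges absolutely at every point, SOLVES `H_V W = g` (the finite stencil passes through the series), and
`|W(p)| ≤ C·M_g·e^{−δD}` whenever `D ≤ |blk n p − c|₁` for every `c ∉ A` — in particular `|W| ≤ C·M_g`. [folklore] -/
theorem zd_block_superposition (hd : 3 ≤ d) (a : ℝ) (ha : 0 < a) {lam Lam : ℝ} (hlam : lam < min 2 a) (hLam : 0 ≤ Lam) :
    ∃ C δ : ℝ, 0 < C ∧ 0 < δ ∧ ∀ (n : ℕ) (V : X d → ℝ), (∀ p, -lam ≤ V p) → (∀ p, V p ≤ Lam) →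
      ∀ (g : X d → ℝ) (Mg : ℝ), (∀ p, |g p| ≤ Mg) → ∀ (A : Set (X d)), (∀ p, blk n p ∈ A → g p = 0) →
      ∃ W : X d → ℝ,
        (∀ p, ((n : ℝ) + 1) ^ 2 * ∑ μ, (2 * W p - W (p + e μ) - W (p - e μ))
          + a / ((n : ℝ) + 1) ^ d * ∑ q ∈ B n (blk n p), W q + V p * W p = g p) ∧
        (∀ p, |W p| ≤ C * Mg) ∧
        (∀ (p : X d) (D : ℝ), (∀ c, c ∉ A → D ≤ ∑ i, (((blk n p i - c i).natAbs : ℕ) : ℝ)) →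
          |W p| ≤ C * Mg * exp (-(δ * D))) := by
  classical
  obtain ⟨C, δ, hC, hδ, H180⟩ := zd_propagator_exists (d := d) hd a ha hlam hLam
  have hδ2 : 0 < δ / 2 := by linarith
  set K : ℝ := (2 * (1 - exp (-(δ / 2)))⁻¹) ^ d with hK
  have hK0 : 0 < K := pow_pos (mul_pos two_pos (inv_pos.2 (sub_pos.2 (exp_lt_one_iff.2 (by linarith))))) d
  refine ⟨C * K, δ / 2, by positivity, hδ2, ?_⟩
  intro n V hV hV' g Mg hg A hgA
  have hMg : 0 ≤ Mg := (abs_nonneg _).trans (hg 0)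
  -- the decaying solutions of the block pieces ((180))
  have hex : ∀ c : X d, ∃ w : X d → ℝ,
      (∀ p, ((n : ℝ) + 1) ^ 2 * ∑ μ, (2 * w p - w (p + e μ) - w (p - e μ))
        + a / ((n : ℝ) + 1) ^ d * ∑ q ∈ B n (blk n p), w q + V p * w p = if blk n p = c then g p else 0) ∧
      (∀ p, exp (δ * ∑ i, (((blk n p i - c i).natAbs : ℕ) : ℝ)) * |w p| ≤ C * Mg) := fun c =>
    H180 n V hV hV' c Mg (fun p => if blk n p = c then g p else 0) (fun p hp => if_neg hp)
      (fun p => by split_ifs; exacts [hg p, by rw [abs_zero]; exact hMg])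
  choose w hw hwdec using hex
  have hwle : ∀ c p, |w c p| ≤ C * Mg * exp (-(δ * ∑ i, (((blk n p i - c i).natAbs : ℕ) : ℝ))) := by
    intro c p
    have h := hwdec c p
    have hE := exp_pos (δ * ∑ i, (((blk n p i - c i).natAbs : ℕ) : ℝ))
    rw [exp_neg, ← div_eq_mul_inv, le_div_iff₀ hE, mul_comm]; exact h
  -- the pieces on `A` vanish ((181))
  have hwA : ∀ c, c ∈ A → w c = 0 := fun c hc =>
    zd_bounded_null_solution_eq_zero hd a ha hlam hLam n V hV hV' (w c) (Bw := C * Mg)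
      (fun p => (le_mul_of_one_le_left (abs_nonneg _) (one_le_exp (by positivity))).trans (hwdec c p)) fun p => by
        rw [hw c p]
        split_ifs with h
        · exact hgA p (h ▸ hc)
        · rfl
  -- absolute convergence in `c` at every point
  have hs : ∀ p, Summable fun c : X d => w c p := fun p =>
    Summable.of_norm_bounded ((summable_exp_l1 hδ (blk n p)).mul_left (C * Mg)) fun c => by
      rw [Real.norm_eq_abs]; exact hwle c p
  -- the decay away from the support
  have hfar : ∀ (p : X d) (D : ℝ), (∀ c, c ∉ A → D ≤ ∑ i, (((blk n p i - c i).natAbs : ℕ) : ℝ)) →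
      |∑' c : X d, w c p| ≤ C * K * Mg * exp (-(δ / 2 * D)) := by
    intro p D hD
    have hpt : ∀ c : X d, |w c p| ≤ C * Mg * exp (-(δ / 2 * D)) * exp (-(δ / 2 * ∑ i, (((blk n p i - c i).natAbs : ℕ) : ℝ))) := by
      intro c
      by_cases hc : c ∈ A
      · rw [hwA c hc, Pi.zero_apply, abs_zero]; positivity
      · refine (hwle c p).trans ?_
        rw [mul_assoc (C * Mg), ← exp_add]
        refine mul_le_mul_of_nonneg_left (exp_le_exp.2 ?_) (by positivity)
        have := hD c hc
        nlinarith
    have hsum2 : Summable fun c : X d => C * Mg * exp (-(δ / 2 * D))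
        * exp (-(δ / 2 * ∑ i, (((blk n p i - c i).natAbs : ℕ) : ℝ))) := (summable_exp_l1 hδ2 (blk n p)).mul_left _
    have h1 : |∑' c : X d, w c p| ≤ ∑' c : X d, |w c p| := by
      have := norm_tsum_le_tsum_norm (hs p).norm
      simpa only [Real.norm_eq_abs] using this
    have h2 : ∑' c : X d, |w c p| ≤ ∑' c : X d, C * Mg * exp (-(δ / 2 * D))
        * exp (-(δ / 2 * ∑ i, (((blk n p i - c i).natAbs : ℕ) : ℝ))) := (hs p).abs.tsum_le_tsum hpt hsum2
    have h3 : ∑' c : X d, C * Mg * exp (-(δ / 2 * D)) * exp (-(δ / 2 * ∑ i, (((blk n p i - c i).natAbs : ℕ) : ℝ)))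
        = C * Mg * exp (-(δ / 2 * D)) * ∑' c : X d, exp (-(δ / 2 * ∑ i, (((blk n p i - c i).natAbs : ℕ) : ℝ))) :=
      (summable_exp_l1 hδ2 (blk n p)).tsum_mul_left _
    have h4 := tsum_exp_l1_le hδ2 (blk n p)
    rw [← hK] at h4
    have h5 : C * Mg * exp (-(δ / 2 * D)) * ∑' c : X d, exp (-(δ / 2 * ∑ i, (((blk n p i - c i).natAbs : ℕ) : ℝ)))
        ≤ C * Mg * exp (-(δ / 2 * D)) * K := mul_le_mul_of_nonneg_left h4 (by positivity)
    calc |∑' c : X d, w c p| ≤ C * Mg * exp (-(δ / 2 * D)) * K := h1.trans (h2.trans (h3.le.trans h5))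
      _ = C * K * Mg * exp (-(δ / 2 * D)) := by ring
  refine ⟨fun p => ∑' c : X d, w c p, fun p => ?_, fun p => ?_, hfar⟩
  · -- the finite stencil passes through the absolutely convergent series
    have hpt : ∑' c : X d, (((n : ℝ) + 1) ^ 2 * ∑ μ, (2 * w c p - w c (p + e μ) - w c (p - e μ))
        + a / ((n : ℝ) + 1) ^ d * ∑ q ∈ B n (blk n p), w c q + V p * w c p) = g p := by
      simp only [hw]
      rw [tsum_eq_single (blk n p) (fun c hc => by rw [if_neg (Ne.symm hc)]), if_pos rfl]
    have hS1 : ∀ μ : Fin d, Summable fun c : X d => 2 * w c p - w c (p + e μ) - w c (p - e μ) :=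
      fun μ => (((hs p).mul_left 2).sub (hs (p + e μ))).sub (hs (p - e μ))
    have hS1s : Summable fun c : X d => ∑ μ, (2 * w c p - w c (p + e μ) - w c (p - e μ)) := summable_sum fun μ _ => hS1 μ
    have hS2 : Summable fun c : X d => ∑ q ∈ B n (blk n p), w c q := summable_sum fun q _ => hs q
    have hT1 : ∑' c : X d, ∑ μ, (2 * w c p - w c (p + e μ) - w c (p - e μ))
        = ∑ μ, (2 * (∑' c : X d, w c p) - (∑' c : X d, w c (p + e μ)) - (∑' c : X d, w c (p - e μ))) := by
      rw [Summable.tsum_finsetSum fun μ _ => hS1 μ]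
      refine Finset.sum_congr rfl fun μ _ => ?_
      rw [(((hs p).mul_left 2).sub (hs (p + e μ))).tsum_sub (hs (p - e μ)), ((hs p).mul_left 2).tsum_sub (hs (p + e μ)),
        (hs p).tsum_mul_left 2]
    have hT2 : ∑' c : X d, ∑ q ∈ B n (blk n p), w c q = ∑ q ∈ B n (blk n p), ∑' c : X d, w c q :=
      Summable.tsum_finsetSum fun q _ => hs q
    have hmain : ∑' c : X d, (((n : ℝ) + 1) ^ 2 * ∑ μ, (2 * w c p - w c (p + e μ) - w c (p - e μ))
        + a / ((n : ℝ) + 1) ^ d * ∑ q ∈ B n (blk n p), w c q + V p * w c p)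
        = ((n : ℝ) + 1) ^ 2 * ∑' c : X d, ∑ μ, (2 * w c p - w c (p + e μ) - w c (p - e μ))
          + a / ((n : ℝ) + 1) ^ d * ∑' c : X d, ∑ q ∈ B n (blk n p), w c q + V p * ∑' c : X d, w c p := by
      rw [Summable.tsum_add ((hS1s.mul_left _).add (hS2.mul_left _)) ((hs p).mul_left _),
        Summable.tsum_add (hS1s.mul_left _) (hS2.mul_left _), hS1s.tsum_mul_left (((n : ℝ) + 1) ^ 2),
        hS2.tsum_mul_left (a / ((n : ℝ) + 1) ^ d), (hs p).tsum_mul_left (V p)]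
    rw [← hpt, hmain, hT1, hT2]
  · -- the global bound: `D = 0`
    have h := hfar p 0 (fun c _ => by positivity)
    rw [mul_zero, neg_zero, exp_zero, mul_one] at h
    exact h

/-! ## §2. THE END: bounded solutions whose data agree on a set of blocks agree there up to `e^{−δ·(distance to the disagreement)}` -/

/-- **HEADLINE — DATA AGREEMENT ⟹ EXPONENTIAL AGREEMENT OF THE BOUNDED SOLUTIONS**: `∃ C δ > 0` from `(d, a, λ, Λ)` such that for ALL
`n`, any two potentials `V₁, V₂ : ℤ^d → [−λ, Λ]`, sources `|f₁|, |f₂| ≤ M` and BOUNDED solutions `H_{V₁}u₁ = f₁`, `H_{V₂}u₂ = f₂` on `ℤ^d`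
whose data agree on the blocks of a set `A` of coarse points (`V₁ = V₂` and `f₁ = f₂` at every `p` with `blk n p ∈ A`):
`|u₁(p) − u₂(p)| ≤ C·M·e^{−δD}` whenever `D ≤ |blk n p − c|₁` for all `c ∉ A` — `u₁ − u₂` is THE bounded solution ((181)) of
`H_{V₁}w = f₁ − f₂ − (V₁ − V₂)u₂`, a source bounded by `(2 + 2(|λ| + Λ)C₀)M` ((180)'s sup bound for `u₂`) and vanishing on the blocks of
`A`, so §1 applies.  The infinite-volume twin of (178) `far_source_decay` ∕ (179) `tower_comparison`. [folklore] -/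
theorem zd_data_agreement (hd : 3 ≤ d) (a : ℝ) (ha : 0 < a) {lam Lam : ℝ} (hlam : lam < min 2 a) (hLam : 0 ≤ Lam) :
    ∃ C δ : ℝ, 0 < C ∧ 0 < δ ∧ ∀ (n : ℕ) (V₁ V₂ : X d → ℝ), (∀ p, -lam ≤ V₁ p) → (∀ p, V₁ p ≤ Lam) →
      (∀ p, -lam ≤ V₂ p) → (∀ p, V₂ p ≤ Lam) →
      ∀ (f₁ f₂ : X d → ℝ) (M : ℝ), (∀ p, |f₁ p| ≤ M) → (∀ p, |f₂ p| ≤ M) →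
      ∀ (u₁ u₂ : X d → ℝ) (B₁ B₂ : ℝ), (∀ p, |u₁ p| ≤ B₁) → (∀ p, |u₂ p| ≤ B₂) →
      (∀ p, ((n : ℝ) + 1) ^ 2 * ∑ μ, (2 * u₁ p - u₁ (p + e μ) - u₁ (p - e μ))
        + a / ((n : ℝ) + 1) ^ d * ∑ q ∈ B n (blk n p), u₁ q + V₁ p * u₁ p = f₁ p) →
      (∀ p, ((n : ℝ) + 1) ^ 2 * ∑ μ, (2 * u₂ p - u₂ (p + e μ) - u₂ (p - e μ))
        + a / ((n : ℝ) + 1) ^ d * ∑ q ∈ B n (blk n p), u₂ q + V₂ p * u₂ p = f₂ p) →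
      ∀ (A : Set (X d)), (∀ p, blk n p ∈ A → V₁ p = V₂ p ∧ f₁ p = f₂ p) →
      ∀ (p : X d) (D : ℝ), (∀ c, c ∉ A → D ≤ ∑ i, (((blk n p i - c i).natAbs : ℕ) : ℝ)) →
        |u₁ p - u₂ p| ≤ C * M * exp (-(δ * D)) := by
  classical
  obtain ⟨C₀, hC₀, H180⟩ := zd_solution_exists (d := d) hd a ha hlam hLam
  obtain ⟨C, δ, hC, hδ, H1⟩ := zd_block_superposition (d := d) hd a ha hlam hLam
  refine ⟨C * (2 + 2 * (|lam| + Lam) * C₀), δ, by positivity, hδ, ?_⟩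
  intro n V₁ V₂ hV₁ hV₁' hV₂ hV₂' f₁ f₂ M hf₁ hf₂ u₁ u₂ B₁ B₂ hu₁B hu₂B hu₁ hu₂ A hA p D hD
  have hM : 0 ≤ M := (abs_nonneg _).trans (hf₁ 0)
  -- `u₂` is (180)'s solution, `|u₂| ≤ C₀M`
  obtain ⟨v₂, hv₂, hv₂B⟩ := H180 n V₂ hV₂ hV₂' M f₂ hf₂
  have hu₂v : u₂ = v₂ := zd_bounded_solution_unique hd a ha hlam hLam n V₂ hV₂ hV₂' f₂ u₂ v₂ hu₂B hv₂B hu₂ hv₂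
  have hu₂C : ∀ q, |u₂ q| ≤ C₀ * M := fun q => by rw [hu₂v]; exact hv₂B q
  have hVabs : ∀ (V : X d → ℝ), (∀ q, -lam ≤ V q) → (∀ q, V q ≤ Lam) → ∀ q, |V q| ≤ |lam| + Lam := fun V h1 h2 q =>
    abs_le.2 ⟨by linarith [h1 q, neg_abs_le lam, le_abs_self lam], by linarith [h2 q, abs_nonneg lam]⟩
  -- the source of the difference
  set g : X d → ℝ := fun q => f₁ q - f₂ q - (V₁ q - V₂ q) * u₂ q with hg
  have hgM : ∀ q, |g q| ≤ (2 + 2 * (|lam| + Lam) * C₀) * M := by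
    intro q
    have e1 := hf₁ q; have e2 := hf₂ q; have e3 := hu₂C q
    have e4 := hVabs V₁ hV₁ hV₁' q; have e5 := hVabs V₂ hV₂ hV₂' q
    have e6 : |(V₁ q - V₂ q) * u₂ q| ≤ (|lam| + Lam + (|lam| + Lam)) * (C₀ * M) := by
      rw [abs_mul]; exact mul_le_mul ((abs_sub _ _).trans (add_le_add e4 e5)) e3 (abs_nonneg _) (by positivity)
    calc |g q| ≤ |f₁ q - f₂ q| + |(V₁ q - V₂ q) * u₂ q| := abs_sub _ _
      _ ≤ (|f₁ q| + |f₂ q|) + |(V₁ q - V₂ q) * u₂ q| := by gcongr; exact abs_sub _ _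
      _ ≤ (M + M) + (|lam| + Lam + (|lam| + Lam)) * (C₀ * M) := by gcongr
      _ = (2 + 2 * (|lam| + Lam) * C₀) * M := by ring
  have hgA : ∀ q, blk n q ∈ A → g q = 0 := fun q hq => by
    obtain ⟨h1, h2⟩ := hA q hq
    simp only [hg, h1, h2, sub_self, zero_mul]
  obtain ⟨W, hWeq, -, hWfar⟩ := H1 n V₁ hV₁ hV₁' g _ hgM A hgA
  -- `u₁ − u₂` solves the same equation and is bounded: it IS `W`
  have hweq : ∀ q, ((n : ℝ) + 1) ^ 2 * ∑ μ, (2 * (u₁ q - u₂ q) - (u₁ (q + e μ) - u₂ (q + e μ)) - (u₁ (q - e μ) - u₂ (q - e μ)))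
      + a / ((n : ℝ) + 1) ^ d * ∑ q' ∈ B n (blk n q), (u₁ q' - u₂ q') + V₁ q * (u₁ q - u₂ q) = g q := by
    intro q
    have e1 : ∑ μ, (2 * (u₁ q - u₂ q) - (u₁ (q + e μ) - u₂ (q + e μ)) - (u₁ (q - e μ) - u₂ (q - e μ)))
        = ∑ μ, (2 * u₁ q - u₁ (q + e μ) - u₁ (q - e μ)) - ∑ μ, (2 * u₂ q - u₂ (q + e μ) - u₂ (q - e μ)) := by
      rw [← Finset.sum_sub_distrib]; exact Finset.sum_congr rfl fun μ _ => by ring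
    have e2 : ∑ q' ∈ B n (blk n q), (u₁ q' - u₂ q') = ∑ q' ∈ B n (blk n q), u₁ q' - ∑ q' ∈ B n (blk n q), u₂ q' :=
      Finset.sum_sub_distrib (f := fun q' => u₁ q') (g := fun q' => u₂ q')
    rw [e1, e2, hg]
    simp only
    rw [← hu₁ q, ← hu₂ q]
    ring
  have hwW : (fun q => u₁ q - u₂ q) = W :=
    zd_bounded_solution_unique hd a ha hlam hLam n V₁ hV₁ hV₁' g (fun q => u₁ q - u₂ q) W (B₁ := B₁ + B₂)
      (B₂ := C * ((2 + 2 * (|lam| + Lam) * C₀) * M))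
      (fun q => (abs_sub _ _).trans (add_le_add (hu₁B q) (hu₂B q)))
      (fun q => by
        have h := hWfar q 0 (fun c _ => by positivity)
        rw [mul_zero, neg_zero, exp_zero, mul_one] at h
        exact h) hweq hWeq
  have h := hWfar p D hD
  rw [← hwW] at h
  calc |u₁ p - u₂ p| ≤ C * ((2 + 2 * (|lam| + Lam) * C₀) * M) * exp (-(δ * D)) := h
    _ = C * (2 + 2 * (|lam| + Lam) * C₀) * M * exp (-(δ * D)) := by ring

/-! ## §3. Toy -/

/-- Toy (`d = 3`, `a = 1`, `λ = 0`, `Λ = 1`): the constants of the agreement estimate exist. -/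
example : ∃ C δ : ℝ, 0 < C ∧ 0 < δ :=
  let ⟨C, δ, hC, hδ, _⟩ := zd_data_agreement (d := 3) le_rfl 1 one_pos (lam := 0) (Lam := 1)
    (by rw [min_eq_right (by norm_num : (1 : ℝ) ≤ 2)]; norm_num) zero_le_one
  ⟨C, δ, hC, hδ⟩

end Summit.QuantumFields.BalabanUV.T4Continuum.NE7b.SupZdDataAgreement
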